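import Summits.QuantumFields.GaugeBoot.CutLoopCharacterPositivity
import Summits.QuantumFields.GaugeBoot.ZdWordSymmetry
import HarnessLib

/-!
# The `R_diag` blocks of a Class-B state, indexed by half-WORDS, with loop-variable entries, are
positive semidefinite (gauge-boot, task L3(α)/(θ′), 4/4)

HONEST FRAMING (cell `pub-gaugeboot`, page 1 of every file): the venture produces certified bounds
on lattice expectations at stated coupling, gauge group, dimension and torus size; NOT a mass gap,
NOT a continuum limit, NOT a string tension; NOT Yang–Mills-summit-bearing (barriers
`FixedCouplingUltralocality`, `PerturbativeInvisibility`). This module is structural bookkeeping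
for the Class-B column (SCOPING A18): it turns the diagonal reflection-positivity AXIOM of a
Class-B state into the concrete PSD blocks a loop-equation certificate with `R_diag` matrices
consumes; it discharges nothing else and certifies no number.

## Content

`ClassBWords.lean` proved the Class-B `H` blocks with loop entries (`ClassBState.gramBlock_nonneg`)
and the `R` blocks ABSTRACTLY (`ClassBState.rpBlock_nonneg`: any finite family of bounded measurable
half-supported observables), leaving "the support bookkeeping that a concrete `R`-block's Wilson-line
entries are `DependsOn … (halfEdges)`" undone. For the DIAGONAL family (mirror `x_i = x_j`, which
passes through lattice SITES, so that Kazakov–Zheng's reflection matrices are indexed by OPEN Wilson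
lines between mirror sites — arXiv:2203.11360 §3.1) this file supplies it:

* the half-word hypothesis is carried at the holonomy level,
  `DependsOn (U ↦ hol_p(O_a)(U)) (diagHalfEdges i j)`; the companion `DiagonalHalfWords.lean`
  supplies the `decide`-able Boolean criterion `Word.diagHalfOK` discharging it on concrete words.
* `Word.endpointZd_map_permute`, `wordHolonomyZd_configDiagSwapZd`: the swapped configuration reads
  the swapped word, `hol_x(w)(Θ_{ij} U) = hol_{θx}((i j)·w)(U)`.
* **`sum_conj_mul_integral_trace_mul_inv_nonneg_of_rp`** (mechanism, any configuration space
  `ι → G`, any continuous `τ`): if the entrywise RP pairings of a finite family of half paths `C_a`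
  with mirror images `D_a = C_a ∘ Θ` are PSD, then the Hermitian matrix
  `(∫ tr τ(C_b D_a⁻¹) dμ)_{ab}` is PSD — `tr τ(g h⁻¹) = Σ_{mk} σ(g)_{mk} conj σ(h)_{mk}`
  (`trace_mul_inv_eq_sum_unitarize`, `σ = unitarize τ`).
* **`sum_conj_mul_integral_trace_diagGlue_nonneg`** — `μ` a finite measure on `LGConfig d G`,
  reflection positive for `configDiagSwapZd i j` / `diagHalfEdges i j`; mirror sites `p, q`
  (`p_i = p_j`, `q_i = q_j`); half-words `O_a : p → q` (holonomy supported in the closed half);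
  then for all `c ∈ ℂ^n`
  `0 ≤ Σ_{ab} c̄_a c_b ∫ tr τ(hol_p(O_b ++ ((i j)·O_a)⁻¹)) dμ` for EVERY continuous `τ`: the
  `R_diag` block with entries the (complex) traces of the GLUED LOOPS `O_b · θ(O_a)⁻¹` is PSD.
* **`ClassBState.rDiagWordBlock_nonneg`** — for a Class-B state and real coefficients, in the
  certificate normalisation `wordLoopZd ρ = (1/N) Re tr ρ`:
  `0 ≤ Σ_{ab} c_a c_b ∫ W_p(O_b ++ ((i j)·O_a)⁻¹) dω.μ`. The `1 × 1` case with `O = [+e_i, +e_j]`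
  is `u_P ≥ 0` (`CutLoopCharacterPositivity.lean`).

## What is NOT claimed

Site/link word blocks on `ℤ^d` (the torus versions are `WordSiteRP` / `WordLinkRP` of lean1; the
`ℤ^d` site family is the same bookkeeping with `configSiteReflect`, not written here); inhabitation
of Class B; anything numerical. All statements are elementary ([folklore] mechanism:
Osterwalder–Seiler 1978 §2; Kazakov–Zheng 2022 §3.1 for the indexing by Wilson lines).
-/

open MeasureTheory Complex Finset Function
open scoped ComplexOrder

namespace Summit.QuantumFields.GaugeBoot

open Literature.MathematicalPhysics.QuantumFieldTheory
open Literature.MathematicalPhysics.QuantumLattice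
open Literature.RepresentationTheory.CompactGroups

noncomputable section

/-! ## Relabelled words -/

namespace Word

variable {d : ℕ}

/-- The endpoint of a relabelled word: `end_{x∘π⁻¹}(π·w) = (end_x w) ∘ π⁻¹`, in the form used with
`wordHolonomyZd_configPerm`. -/
theorem endpointZd_map_permute (σ : Equiv.Perm (Fin d)) :
    ∀ (x : Fin d → ℤ) (w : Word d),
      endpointZd (x ∘ σ) (w.map (Step.permute σ.symm)) = (endpointZd x w) ∘ σ
  | x, [] => rfl
  | x, s :: w => by
    rw [List.map_cons, endpointZd_cons, endpointZd_cons, ← applyZd_comp_perm,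
      endpointZd_map_permute σ (s.applyZd x) w]

end Word

/-! ## Holonomy bookkeeping -/

section Holonomy

variable {d : ℕ} {G : Type*} [Group G]

/-- A step holonomy depends only on the link it traverses. -/
theorem stepHolonomyZd_congr {U V : LGConfig d G} (y : Fin d → ℤ) (s : Step d)
    (h : U (s.edgeZd y) = V (s.edgeZd y)) : stepHolonomyZd U y s = stepHolonomyZd V y s := by
  cases s with
  | fwd μ => simpa using h
  | bwd μ => simpa using congrArg (·⁻¹) h

omit [Group G] in
/-- The diagonal swap of configurations is the axis permutation by the transposition `(i j)`. -/
theorem configDiagSwapZd_eq_configPerm (i j : Fin d) :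
    (configDiagSwapZd i j : LGConfig d G → LGConfig d G) = configPerm (Equiv.swap i j) := by
  funext U e
  simp only [configDiagSwapZd, configPerm, Equiv.symm_swap]
  rfl

/-- **The swapped configuration reads the swapped word**:
`hol_x(w)(Θ_{ij} U) = hol_{θx}((i j)·w)(U)`. -/
theorem wordHolonomyZd_configDiagSwapZd (i j : Fin d) (U : LGConfig d G) (x : Fin d → ℤ) (w : Word d) :
    wordHolonomyZd (configDiagSwapZd i j U) x w =
      wordHolonomyZd U (zdDiagSwap i j x) (w.map (Step.permute (Equiv.swap i j))) := by
  rw [configDiagSwapZd_eq_configPerm, wordHolonomyZd_configPerm, Equiv.symm_swap]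
  rfl

/-- A mirror site (`x_i = x_j`) read through the transposition is itself. -/
theorem comp_swap_of_eq {i j : Fin d} {x : Fin d → ℤ} (hx : x i = x j) : x ∘ Equiv.swap i j = x :=
  DiagRP.zdDiagSwap_of_eq i j hx

end Holonomy

/-! ## The mechanism for blocks -/

section Mechanism

variable {ι : Type*} {M : ℕ} {G : Type*} [Group G] [TopologicalSpace G] [IsTopologicalGroup G]
  [CompactSpace G] [MeasurableSpace G] (τ : G →* Matrix (Fin M) (Fin M) ℂ)

omit [MeasurableSpace G] in
/-- `tr τ(g h⁻¹) = Σ_{m,k} σ(g)_{mk} conj σ(h)_{mk}` for the unitarisation `σ` of `τ` (the complex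
form of the tree's `CompactGroup.re_trace_mul_inv_eq_sum`). -/
theorem trace_mul_inv_eq_sum_unitarize (hτ : Continuous τ) (g h : G) :
    (τ (g * h⁻¹)).trace = ∑ m, ∑ k, CompactGroup.unitarize τ hτ g m k *
      (starRingEnd ℂ) (CompactGroup.unitarize τ hτ h m k) := by
  rw [← CompactGroup.trace_unitarize τ hτ, map_mul, CompactGroup.unitarize_inv,
    Matrix.star_eq_conjTranspose, Matrix.trace]
  simp only [Matrix.diag_apply, Matrix.mul_apply, Matrix.conjTranspose_apply, Complex.star_def]

/-- ★★ **Entrywise RP pairings of half paths control the glued-loop block.** `τ` continuous,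
`σ = unitarize τ`; `μ` a finite measure on `ι → G`; half paths `C_a` with mirror images
`D_a = C_a ∘ Θ`, all entrywise measurable. If for every matrix position `(m, k)` and all `c ∈ ℂ^n`
`0 ≤ Σ_{ab} c̄_a c_b ∫ (σ(C_a(ΘU))_{mk})‾ σ(C_b U)_{mk} dμ` (what reflection positivity of `μ` gives
for half-supported `C_a`), then `0 ≤ Σ_{ab} c̄_a c_b ∫ tr τ(C_b U (D_a U)⁻¹) dμ`. -/
theorem sum_conj_mul_integral_trace_mul_inv_nonneg_of_rp (hτ : Continuous τ) {μ : Measure (ι → G)}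
    [IsFiniteMeasure μ] {Θ : (ι → G) → (ι → G)} {n : ℕ} {C D : Fin n → (ι → G) → G}
    (hC : ∀ a, WilsonRP.EntryMeasurable (CompactGroup.unitarize τ hτ) (C a))
    (hD : ∀ a, WilsonRP.EntryMeasurable (CompactGroup.unitarize τ hτ) (D a))
    (hΘ : ∀ a U, C a (Θ U) = D a U)
    (hRP : ∀ (m k : Fin M) (c : Fin n → ℂ), 0 ≤ ∑ a, ∑ b, (starRingEnd ℂ) (c a) * c b *
      ∫ U, (starRingEnd ℂ) (CompactGroup.unitarize τ hτ (C a (Θ U)) m k) *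
        CompactGroup.unitarize τ hτ (C b U) m k ∂μ)
    (c : Fin n → ℂ) :
    0 ≤ ∑ a, ∑ b, (starRingEnd ℂ) (c a) * c b * ∫ U, (τ (C b U * (D a U)⁻¹)).trace ∂μ := by
  set σ := CompactGroup.unitarize τ hτ with hσ
  -- the pairing integrands
  set f : Fin n → Fin n → Fin M → Fin M → (ι → G) → ℂ :=
    fun a b m k U => (starRingEnd ℂ) (σ (D a U) m k) * σ (C b U) m k with hf
  have hfm : ∀ a b m k, Measurable (f a b m k) := fun a b m k =>
    (Complex.continuous_conj.measurable.comp (hD a m k)).mul (hC b m k)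
  have hfb : ∀ a b m k U, ‖f a b m k U‖ ≤ 1 := fun a b m k U => by
    rw [hf, norm_mul, Complex.norm_conj]
    calc ‖σ (D a U) m k‖ * ‖σ (C b U) m k‖ ≤ 1 * 1 :=
          mul_le_mul (CompactGroup.norm_unitarize_apply_le_one τ hτ _ m k)
            (CompactGroup.norm_unitarize_apply_le_one τ hτ _ m k) (norm_nonneg _) zero_le_one
      _ = 1 := one_mul 1
  have hfi : ∀ a b m k, Integrable (f a b m k) μ := fun a b m k =>
    Integrable.of_bound (hfm a b m k).aestronglyMeasurable 1 (ae_of_all _ (hfb a b m k))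
  -- each matrix position gives a non-negative Hermitian form
  have hpos : ∀ m k, 0 ≤ ∑ a, ∑ b, (starRingEnd ℂ) (c a) * c b * ∫ U, f a b m k U ∂μ := by
    intro m k
    have h := hRP m k c
    simp_rw [hΘ] at h
    exact h
  -- the glued trace is the sum over positions
  have hptw : ∀ a b U, (τ (C b U * (D a U)⁻¹)).trace = ∑ m, ∑ k, f a b m k U := fun a b U => by
    rw [trace_mul_inv_eq_sum_unitarize τ hτ]
    exact Finset.sum_congr rfl fun m _ => Finset.sum_congr rfl fun k _ => mul_comm _ _
  have htr : ∀ a b, ∫ U, (τ (C b U * (D a U)⁻¹)).trace ∂μ = ∑ m, ∑ k, ∫ U, f a b m k U ∂μ :=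
    fun a b => by
    simp_rw [hptw]
    rw [integral_finsetSum _ fun m _ => integrable_finsetSum _ fun k _ => hfi a b m k]
    exact Finset.sum_congr rfl fun m _ => integral_finsetSum _ fun k _ => hfi a b m k
  simp_rw [htr, Finset.mul_sum]
  -- exchange the order of summation: `Σ_a Σ_b Σ_m Σ_k = Σ_m Σ_k Σ_a Σ_b`
  set X : Fin n → Fin n → Fin M → Fin M → ℂ :=
    fun a b m k => (starRingEnd ℂ) (c a) * c b * ∫ U, f a b m k U ∂μ with hX
  calc (0 : ℂ) ≤ ∑ m, ∑ k, ∑ a, ∑ b, X a b m k :=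
        Finset.sum_nonneg fun m _ => Finset.sum_nonneg fun k _ => hpos m k
    _ = ∑ m, ∑ a, ∑ k, ∑ b, X a b m k := Finset.sum_congr rfl fun m _ => Finset.sum_comm
    _ = ∑ a, ∑ m, ∑ k, ∑ b, X a b m k := Finset.sum_comm
    _ = ∑ a, ∑ m, ∑ b, ∑ k, X a b m k :=
        Finset.sum_congr rfl fun a _ => Finset.sum_congr rfl fun m _ => Finset.sum_comm
    _ = ∑ a, ∑ b, ∑ m, ∑ k, X a b m k := Finset.sum_congr rfl fun a _ => Finset.sum_comm

end Mechanism

/-! ## Diagonal-RP states on `ℤ^d`: blocks indexed by half-words -/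

section Zd

variable {d N M : ℕ} {G : Type*} [Group G] [TopologicalSpace G] [IsTopologicalGroup G]
  [CompactSpace G] [MeasurableSpace G] [BorelSpace G] (ρ : G →* Matrix (Fin N) (Fin N) ℂ)
  (τ : G →* Matrix (Fin M) (Fin M) ℂ)

omit [TopologicalSpace G] [IsTopologicalGroup G] [CompactSpace G] [MeasurableSpace G] [BorelSpace G] in
/-- The holonomy of the glued loop `O_b ++ ((i j)·O_a)⁻¹` at the mirror site `p`
(`p_i = p_j`; `O_a, O_b : p → q` with `q_i = q_j`) is `hol_p(O_b)(U) · (hol_p(O_a)(Θ U))⁻¹`. -/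
theorem wordHolonomyZd_diagGlue {i j : Fin d} {p q : Fin d → ℤ} (hp : p i = p j) (hq : q i = q j)
    (U : LGConfig d G) {Oa Ob : Word d} (ha : Word.endpointZd p Oa = q)
    (hb : Word.endpointZd p Ob = q) :
    wordHolonomyZd U p (Ob ++ Word.reverse (Oa.map (Step.permute (Equiv.swap i j)))) =
      wordHolonomyZd U p Ob * (wordHolonomyZd (configDiagSwapZd i j U) p Oa)⁻¹ := by
  have hend : Word.endpointZd p (Oa.map (Step.permute (Equiv.swap i j))) = q := by
    have h := Word.endpointZd_map_permute (Equiv.swap i j) p Oa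
    rw [Equiv.symm_swap, comp_swap_of_eq hp, ha, comp_swap_of_eq hq] at h
    exact h
  rw [wordHolonomyZd_append, hb, ← hend, wordHolonomyZd_reverse, wordHolonomyZd_configDiagSwapZd,
    DiagRP.zdDiagSwap_of_eq i j hp]

/-- ★★★ **The `R_diag` block of a diagonally reflection-positive state, indexed by half-WORDS, is
PSD — with GLUED-LOOP TRACE entries, in every representation.** `μ` a finite measure on
`LGConfig d G`, reflection positive for the swap `configDiagSwapZd i j` on the closed half
`diagHalfEdges i j`; mirror sites `p, q` (`p_i = p_j`, `q_i = q_j`); words `O_a : p → q` inside the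
closed half (`hol_p(O_a)` depends only on `diagHalfEdges i j`); `τ` any continuous
representation; `c ∈ ℂ^n`:
`0 ≤ Σ_{ab} c̄_a c_b ∫ tr τ(hol_p(O_b ++ ((i j)·O_a)⁻¹)) dμ`. -/
theorem sum_conj_mul_integral_trace_diagGlue_nonneg (hτ : Continuous τ)
    {μ : Measure (LGConfig d G)} [IsFiniteMeasure μ] {i j : Fin d}
    (hRP : IsReflectionPositiveFor (configDiagSwapZd i j) (diagHalfEdges i j) μ)
    {p q : Fin d → ℤ} (hp : p i = p j) (hq : q i = q j) {n : ℕ} (O : Fin n → Word d)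
    (hend : ∀ a, Word.endpointZd p (O a) = q)
    (hhalf : ∀ a, DependsOn (fun U : LGConfig d G => wordHolonomyZd U p (O a)) (diagHalfEdges i j))
    (c : Fin n → ℂ) :
    0 ≤ ∑ a, ∑ b, (starRingEnd ℂ) (c a) * c b *
      ∫ U, (τ (wordHolonomyZd U p
        (O b ++ Word.reverse ((O a).map (Step.permute (Equiv.swap i j)))))).trace ∂μ := by
  have hσc : Continuous (CompactGroup.unitarize τ hτ) := CompactGroup.continuous_unitarize τ hτ
  have hΘm : Measurable (configDiagSwapZd (G := G) i j) :=
    measurable_pi_lambda _ fun e => measurable_pi_apply _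
  simp_rw [wordHolonomyZd_diagGlue hp hq _ (hend _) (hend _)]
  refine sum_conj_mul_integral_trace_mul_inv_nonneg_of_rp τ hτ (Θ := configDiagSwapZd i j)
    (C := fun a U => wordHolonomyZd U p (O a))
    (D := fun a U => wordHolonomyZd (configDiagSwapZd i j U) p (O a))
    (fun a => entryMeasurable_wordHolonomyZd _ hσc (O a) p) (fun a => ?_) (fun a U => rfl)
    (fun m k c' => ?_) c
  · have hDa : (fun U : LGConfig d G => wordHolonomyZd (configDiagSwapZd i j U) p (O a)) =
        fun U => wordHolonomyZd U (zdDiagSwap i j p) ((O a).map (Step.permute (Equiv.swap i j))) :=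
      funext fun U => wordHolonomyZd_configDiagSwapZd i j U p (O a)
    rw [hDa]
    exact entryMeasurable_wordHolonomyZd _ hσc _ _
  · exact hRP.sum_mul_conj_nonneg hΘm
      (fun a U => CompactGroup.unitarize τ hτ (wordHolonomyZd U p (O a)) m k)
      (fun a => entryMeasurable_wordHolonomyZd _ hσc (O a) p m k)
      (fun a => ⟨1, fun U => CompactGroup.norm_unitarize_apply_le_one τ hτ _ m k⟩)
      (fun a => fun U V hUV => by
        have h : wordHolonomyZd U p (O a) = wordHolonomyZd V p (O a) := hhalf a hUV
        simp only [h]) c'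

/-- ★★★ **Class-B `R_diag` blocks with loop-variable entries.** For a Class-B state `ω`, the
representation `ρ` of the action (continuous), `i ≠ j`, mirror sites `p, q`, half-words
`O_a : p → q` (holonomies supported in the closed half) and REAL coefficients: in the certificate normalisation
`W = (1/N) Re tr ρ` (`wordLoopZd`),
`0 ≤ Σ_{ab} c_a c_b ∫ W_p(O_b ++ ((i j)·O_a)⁻¹) dω.μ`.
The `1 × 1` block of the half plaquette `O = [+e_i, +e_j]` at `p = 0` is `u_P ≥ 0`
(`ClassBState.integral_plaquetteObs_nonneg`). -/
theorem ClassBState.rDiagWordBlock_nonneg {β : ℝ} (ω : ClassBState d ρ β) (hρ : Continuous ρ)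
    {i j : Fin d} (hij : i ≠ j) {p q : Fin d → ℤ} (hp : p i = p j) (hq : q i = q j) {n : ℕ}
    (O : Fin n → Word d) (hend : ∀ a, Word.endpointZd p (O a) = q)
    (hhalf : ∀ a, DependsOn (fun U : LGConfig d G => wordHolonomyZd U p (O a)) (diagHalfEdges i j))
    (c : Fin n → ℝ) :
    0 ≤ ∑ a, ∑ b, c a * c b * ∫ U, wordLoopZd ρ p
      (O b ++ Word.reverse ((O a).map (Step.permute (Equiv.swap i j)))) U ∂ω.μ := by
  haveI := ω.isProbabilityMeasure
  have h := sum_conj_mul_integral_trace_diagGlue_nonneg ρ hρ (ω.diagRP i j hij) hp hq O hend hhalf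
    (fun a => (c a : ℂ))
  -- abbreviate the glued words
  set w : Fin n → Fin n → Word d :=
    fun a b => O b ++ Word.reverse ((O a).map (Step.permute (Equiv.swap i j))) with hw
  -- integrability of the complex traces
  have hE : ∀ a b, WilsonRP.EntryMeasurable ρ (fun U : LGConfig d G => wordHolonomyZd U p (w a b)) :=
    fun a b => entryMeasurable_wordHolonomyZd ρ hρ (w a b) p
  have htm : ∀ a b, Measurable fun U : LGConfig d G => (ρ (wordHolonomyZd U p (w a b))).trace :=
    fun a b => by
    simp only [Matrix.trace, Matrix.diag_apply]
    exact Finset.measurable_sum _ fun k _ => hE a b k k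
  have htb : ∀ (g : G), ‖(ρ g).trace‖ ≤ N := fun g => by
    rw [← CompactGroup.trace_unitarize ρ hρ g, Matrix.trace]
    calc ‖∑ k, Matrix.diag (CompactGroup.unitarize ρ hρ g) k‖
        ≤ ∑ k, ‖Matrix.diag (CompactGroup.unitarize ρ hρ g) k‖ := norm_sum_le _ _
      _ ≤ ∑ _k : Fin N, (1 : ℝ) := Finset.sum_le_sum fun k _ => by
          rw [Matrix.diag_apply]; exact CompactGroup.norm_unitarize_apply_le_one ρ hρ g k k
      _ = N := by simp
  have hti : ∀ a b, Integrable (fun U : LGConfig d G => (ρ (wordHolonomyZd U p (w a b))).trace) ω.μ :=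
    fun a b => Integrable.of_bound (htm a b).aestronglyMeasurable (N : ℝ) (ae_of_all _ fun U => htb _)
  -- `∫ W = N⁻¹ Re ∫ tr`
  have hW : ∀ a b, ∫ U, wordLoopZd ρ p (w a b) U ∂ω.μ =
      (N : ℝ)⁻¹ * (∫ U, (ρ (wordHolonomyZd U p (w a b))).trace ∂ω.μ).re := fun a b => by
    simp only [wordLoopZd_apply]
    rw [integral_const_mul]
    have hre := integral_re (hti a b)
    simp only [RCLike.re_to_complex] at hre
    rw [hre]
  have key : ∑ a, ∑ b, c a * c b * ∫ U, wordLoopZd ρ p (w a b) U ∂ω.μ =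
      (N : ℝ)⁻¹ * (∑ a, ∑ b, (starRingEnd ℂ) (c a : ℂ) * (c b : ℂ) *
        ∫ U, (ρ (wordHolonomyZd U p (w a b))).trace ∂ω.μ).re := by
    rw [Complex.re_sum, Finset.mul_sum]
    refine Finset.sum_congr rfl fun a _ => ?_
    rw [Complex.re_sum, Finset.mul_sum]
    refine Finset.sum_congr rfl fun b _ => ?_
    rw [hW, Complex.conj_ofReal, mul_assoc (c a : ℂ), Complex.re_ofReal_mul, Complex.re_ofReal_mul]
    ring
  rw [key]
  exact mul_nonneg (inv_nonneg.2 (Nat.cast_nonneg N)) (Complex.nonneg_iff.1 h).1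

end Zd

end

end Summit.QuantumFields.GaugeBoot
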